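import Summits.BirchSwinnertonDyer.BirchSwinnertonDyer.Theorems.ByReductionTypeAtTwoSupersingularFlatBlindCardHonda
import Summits.BirchSwinnertonDyer.BirchSwinnertonDyer.Theorems.ByReductionTypeAtTwoSupersingularFlatBlindPositionAlgebra
import Summits.BirchSwinnertonDyer.BirchSwinnertonDyer.Theorems.ByReductionTypeAtTwoSupersingularFlatBlindRelaxedStrictCount
import HarnessLib

/-!
# Route `ByReductionTypeAtTwo` (rung K4), crux `SupersingularRankZeroAtTwo` (item stmt-BirchSwinnertonDyer-19097), line
# `odd_blind_package` (registry v2.10.1), slot 5 `stub_CD` = CDC_H `OddBlindPackage.FlatBlindControlCardHondaAtTwo`: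
# **CDC_H MODULO THE ONE PRINT BINDER hPT** (cell `bsd-2adic`, LEAD ss-1 GEN 22)

HONEST FRAMING: THEOREMS ONLY (no definition, no named fact, no `sorry`, no instance); a helper
(`--supports stmt-BirchSwinnertonDyer-19097`). `flatBlindControlCardHondaAtTwo_of_PT (hPT) : ‹body of CDC_H, VERBATIM›` —
the registry's slot 5 statement `OddBlindPackage.FlatBlindControlCardHondaAtTwo` (v2.10.1 `Lines/odd_blind_package.lean` :826–858)
follows from the single PRINT BINDER `hPT = Literature.NumberTheory.GaloisCohomology.poitouTate_selmerStructure_duality_real ℚ`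
(Poitou–Tate duality for finite Selmer structures over `ℚ` with the real places; Milne, *Arithmetic Duality Theorems*, I Thm. 4.10 —
a cited `def … : Prop` of Literature, TAKEN AS A HYPOTHESIS, not proved in the tree). Assembly, every piece a tree theorem BY NAME:
(hglob) = (P2) ★★ `HTC7globAlg_natCard_selmerGroup_of_complement_of_relaxedCount` ∘ (P1) ★★ p819324 `HTC7globPT_natCard_kummerRelaxed_eq hPT`
(`hglob_of_PT`), then ★★★ p819752 `flatBlindControlCardHondaAtTwo_of_glob hPT hglob` (which feeds B1 ★★ p817249, B2′ ★★ p818264, hE ★★★ p819388,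
the local Euler–Poincaré theorem, B5 ★ p815278 and the re-cut glue ★★ p819618). So the line's slot 5 is CLOSED MODULO hPT: the successor
registry (v2.11) may retire `stub_CD` by `exact flatBlindControlCardHondaAtTwo_of_PT stub_PT` once `hPT` is declared among the published
inputs. This is a CONDITIONAL result (`proof.conditional` on hPT); nothing is booked; 19097 stays OPEN (six other stubs + hPT); BSD is proved
for no curve by any of this. bears_on: K4 (19097).

References: [MilneADT2006] I Thm. 2.8, I Thm. 4.10; [GreenbergLNM1716] §3–§4; [Sprung2012] Def. 7.9/7.11, Thm. 2.2.
-/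

set_option autoImplicit false
set_option linter.dupNamespace false

noncomputable section

open scoped Classical NumberField AddSubgroup ContRepresentation

namespace Summit.BirchSwinnertonDyer.BirchSwinnertonDyer.Theorems

namespace OddBlindLocal

open NumberField IsDedekindDomain Field WeierstrassCurve Literature.NumberTheory.EllipticCurves
  Literature.NumberTheory.EllipticCurves.IwasawaDual Literature.NumberTheory.GaloisRepresentations
  Literature.NumberTheory.GaloisCohomology ZpExtension Literature.NumberTheory.EllipticCurves.Kobayashi2003
  Literature.NumberTheory.EllipticCurves.Sprung2017 Literature.NumberTheory.EllipticCurves.Sprung2012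
  Literature.NumberTheory.EllipticCurves.Rank1Residual Summit.BirchSwinnertonDyer.Rank1Residual.Additive
open Literature.NumberTheory.GaloisRepresentations.DiscreteGaloisModule (SelmerStructure)
open Summit.BirchSwinnertonDyer.Rank1Residual.X11b

/-- ★★ **(hglob) MODULO hPT**: the generic «position count for a complementary line» (binder `hglob` of ★★ p816472
`position_of_complement_of_lineCount`, VERBATIM) from the print binder `hPT`, as (P2) ∘ (P1):
`HTC7globAlg_natCard_selmerGroup_of_complement_of_relaxedCount … (HTC7globPT_natCard_kummerRelaxed_eq hPT …)`.
[cite: GreenbergLNM1716, §4 pp. 122–124] [cite: MilneADT2006, I Thm. 4.10] -/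
theorem hglob_of_PT (hPT : Literature.NumberTheory.GaloisCohomology.poitouTate_selmerStructure_duality_real ℚ) :
    ∀ (E : WeierstrassCurve ℚ) [E.IsElliptic] (p : ℕ) [Fact p.Prime]
      (v : HeightOneSpectrum (𝓞 ℚ)), ((p : ℕ) : 𝓞 ℚ) ∈ v.asIdeal →
      (∀ P : (E.baseChange (v.adicCompletion ℚ)).toAffine.Point, p • P = 0 → P = 0) →
      (∀ P : (E.baseChange ℚ_[p]).toAffine.Point, p • P = 0 → P = 0) →
      (∀ P : E.toAffine.Point, p • P = 0 → P = 0) →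
      E.mordellWeilRank = 1 → Finite (AddCommGroup.primaryComponent E.sha p) →
      ∃ J₂ : ℕ, ∀ J : ℕ, J₂ ≤ J →
      ∀ (L : AddSubgroup (galoisCohomology ((E.torsionGaloisModule ((p ^ J : ℕ) : ℤ)).restrictField (v.adicCompletion ℚ)) 1)),
        L ⊓ E.kummerLocalConditionAt ((p ^ J : ℕ) : ℤ) (v.adicCompletion ℚ) = ⊥ →
        L ⊔ E.kummerLocalConditionAt ((p ^ J : ℕ) : ℤ) (v.adicCompletion ℚ) = ⊤ →
      ∀ (𝓛 : SelmerStructure (E.torsionGaloisModule ((p ^ J : ℕ) : ℤ))),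
        (∀ w : InfinitePlace ℚ, 𝓛 (Sum.inl w) = E.kummerLocalConditionAt ((p ^ J : ℕ) : ℤ) w.Completion) →
        𝓛 (Sum.inr v) = L →
        (∀ v' : HeightOneSpectrum (𝓞 ℚ), v' ≠ v → 𝓛 (Sum.inr v') = E.kummerLocalConditionAt ((p ^ J : ℕ) : ℤ) (v'.adicCompletion ℚ)) →
      ∀ (lam : (E.baseChange ℚ_[p]).toAffine.Point →+ ℤ_[p]), (∀ X, lam X = 0 ↔ IsOfFinAddOrder X) → Function.Surjective lam →
      ∀ (P₁ : E.toAffine.Point), (∀ P : E.toAffine.Point, ∃ (a : ℤ) (t : E.toAffine.Point), IsOfFinAddOrder t ∧ P = a • P₁ + t) →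
        Nat.card 𝓛.selmerGroup =
          Nat.card ↥(E.selmerGroupPInfty p ⊓ selmerLocalKerPrimaryTorsion E ℚ_[p] p) *
            p ^ (lam (Affine.Point.baseChange (W' := E) ℚ ℚ_[p] P₁)).valuation :=
  fun E _ p _ v hv h0v h0p h0 hr hsha ↦
    HTC7globAlg_natCard_selmerGroup_of_complement_of_relaxedCount E p v hv h0v h0p h0 hr hsha
      (HTC7globPT_natCard_kummerRelaxed_eq hPT E p v hv h0v h0)

/-- ★★★ **CDC_H MODULO hPT.** The registry statement `OddBlindPackage.FlatBlindControlCardHondaAtTwo` (slot 5 `stub_CD` of line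
`odd_blind_package` v2.10.1; body VERBATIM as the conclusion) from the ONE print binder `hPT` (Milne ADT I 4.10, cited `Prop`, taken as a
hypothesis): `flatBlindControlCardHondaAtTwo_of_glob hPT (hglob_of_PT hPT)`. CONDITIONAL on hPT; a reduction of the slot to print, not a
proof of the crux; 19097 stays OPEN; BSD is proved for no curve. [cite: MilneADT2006, I Thm. 4.10] [cite: GreenbergLNM1716, §3 Lemma 3.3 and §4 pp. 122–124]
[cite: Sprung2012, Def. 7.9, Def. 7.11, Thm. 2.2] -/
theorem flatBlindControlCardHondaAtTwo_of_PT (hPT : Literature.NumberTheory.GaloisCohomology.poitouTate_selmerStructure_duality_real ℚ) :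
    ∀ (W : WeierstrassCurve ℚ) [W.IsElliptic] [W.IsGloballyMinimal],
    ¬ W.HasCM → GoodSS W 2 → W.rootNumber * ZMod.χ₈ (W.conductorNorm ℤ : ZMod 8) = -1 →
    ∀ (κ : ZpExtension ℚ 2) (γ : Field.absoluteGaloisGroup ℚ),
      κ.IsCyclotomic → κ.IsTopGenerator γ → IsCyclotomicVariable 2 γ →
    ∀ (v : HeightOneSpectrum (𝓞 ℚ)), (2 : 𝓞 ℚ) ∈ v.asIdeal →
    ∀ (g : Field.absoluteGaloisGroup (v.adicCompletion ℚ)) (c : ℕ → localPoints W (v.adicCompletion ℚ)),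
      κ.IsTopGenerator (resGalOfEmb (closureEmb (K := ℚ) (v.adicCompletion ℚ)) g) →
      (∀ n, c n ∈ localLayerPointsOfEmb κ (closureEmb (K := ℚ) (v.adicCompletion ℚ)) W n) →
      (∀ n, 1 ≤ n → localTraceOfEmb κ (closureEmb (K := ℚ) (v.adicCompletion ℚ)) W n (n + 1)
        (c (n + 1)) = W.frobeniusTrace 2 • c n - c (n - 1)) →
      (∀ z₀ : localLayerPointsOfEmb κ (closureEmb (K := ℚ) (v.adicCompletion ℚ)) W 0 →+ ℤ_[2],
        evalOn W (localLayerPointsOfEmb κ (closureEmb (K := ℚ) (v.adicCompletion ℚ)) W 0) z₀ (c 0) = 0 →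
          z₀ = 0) →
      (∀ a : ℤ_[2],
        (∃ z₀ : localLayerPointsOfEmb κ (closureEmb (K := ℚ) (v.adicCompletion ℚ)) W 0 →+ ℤ_[2],
          evalOn W (localLayerPointsOfEmb κ (closureEmb (K := ℚ) (v.adicCompletion ℚ)) W 0) z₀ (c 0) = 2 * a) →
        ∃ y : localLayerPointsOfEmb κ (closureEmb (K := ℚ) (v.adicCompletion ℚ)) W 0 →+ ℤ_[2],
          evalOn W (localLayerPointsOfEmb κ (closureEmb (K := ℚ) (v.adicCompletion ℚ)) W 0) y (c 0) = a) →
      (∃ cneg : localPoints W (v.adicCompletion ℚ),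
        Summit.BirchSwinnertonDyer.Rank1Residual.F1Sign2.IsHondaSystemAtTwo κ (closureEmb (K := ℚ) (v.adicCompletion ℚ)) W
          (W.frobeniusTrace 2) g cneg c) →
    ∀ (W₂ : WeierstrassCurve ℚ) [W₂.IsElliptic] [W₂.IsGloballyMinimal],
      (∃ C : WeierstrassCurve.VariableChange ℚ, C • W.quadraticTwist 2 = W₂) →
      W₂.mordellWeilRank = 1 → Finite (AddCommGroup.primaryComponent W₂.sha 2) →
    ∀ (ι : ℚ →+* ℚ_[2]) (P : (W₂.baseChange ℚ).toAffine.Point), ¬ IsOfFinAddOrder P →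
      Finite (endInvariants (conjSharpFlatSelmerInfty W κ (closureEmb (K := ℚ) (v.adicCompletion ℚ))
        (W.frobeniusTrace 2) g c .flat γ + 1)) →
      (padicValNat 2 (Nat.card (endInvariants (conjSharpFlatSelmerInfty W κ
          (closureEmb (K := ℚ) (v.adicCompletion ℚ)) (W.frobeniusTrace 2) g c .flat γ + 1))) : ℤ) =
        (padicValNat 2 (Nat.card (AddCommGroup.primaryComponent W₂.sha 2)) : ℤ) +
          (padicValNat 2 W₂.tamagawaProduct : ℤ) +
          2 * (Literature.NumberTheory.EllipticCurves.padicLogOrd W₂ 2 ι P -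
            (padicValNat 2 (AddSubgroup.zmultiples P).index : ℤ)) :=
  flatBlindControlCardHondaAtTwo_of_glob hPT (hglob_of_PT hPT)

end OddBlindLocal

end Summit.BirchSwinnertonDyer.BirchSwinnertonDyer.Theorems

end
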